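import Summits.QuantumFields.QCD.Theorems.GaussianLinkFramesFrameAPrioriBoundLineDefs
import Summits.QuantumFields.QCD.Theorems.PauliWegnerSeaPhaseQuenchedFlavourDecayNegMomentSmallBalls
import Literature.MathematicalPhysics.QuantumFieldTheory.QCDPhaseQuenched
import Literature.MathematicalPhysics.QuantumFieldTheory.Multiboson

/-!
# Crux `FrameAPrioriBound` (stmt-QuantumFields-17374), line `cube-cofactor` — stub `stub_fibreMoment`

The probabilistic core on the two-cube fibre.  For the shifted Hermitian Wilson–Dirac kernel
`hz V m₀ z = γ₅ D_W(V; m₀, 1) − z` and the refit `W ↦ refit (touches x y) U W` (links touching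
`Q₂(x) ∪ Q₂(y)` re-sampled from `W`, the rest kept from `U`):

* hypothesis 1 (relative small balls): `Haar^{⊗E} {W | |det hz(refit W)| ≤ ε |det hz(refit W₀)|}
  ≤ c ε^α` whenever `det hz(refit W₀) ≠ 0`;
* hypothesis 2 (cofactor domination): the `(x, y)` adjugate block of `hz (refit W₀)` is bounded in
  `ℓ¹` by `C₁ · |det hz(refit W')|` for some fibre point `W'`;

conclusion: for `s := min (α/2) (1/2)` and `C₀ := K · C₁ ^ s` (`K` the layer-cake constant of
`(c, α, s)`), uniformly in `L ≥ 4`, `|m₀| ≤ 2`, `Im z ≠ 0`, `|z| ≤ 1`, `x, y, U`,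
`∫ (Σ_{a,i,b,j} |(hz(refit W)⁻¹)_{(x,a,i),(y,b,j)}|)^s dHaar^{⊗E}(W) ≤ C₀`.

Proof.  `Fd W := |det hz(refit W)|` is continuous on the compact group `SU(3)^E`, and positive
everywhere because `γ₅ D_W` is Hermitian and `Im z ≠ 0` (`det_sub_smul_one_ne_zero_of_isHermitian`);
at a maximiser `W⋆` put `F₀ := Fd W⋆ > 0`.  Hypothesis 1 at `W₀ := W⋆` is the small-ball input of
the dyadic layer cake `CrossingSplitIntegrability.stub_negMomentOfSmallBalls`, whence
`∫ Fd^(-s) ≤ K F₀^(-s)`.  Pointwise, `A⁻¹ = (det A)⁻¹ • adj A` and hypothesis 2 (at `W₀ := W`) with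
maximality give `G W · Fd W = Σ |adj| ≤ C₁ F₀`, so `G W ^ s ≤ (C₁ F₀)^s Fd W^(-s)`; integrate.
-/

noncomputable section

namespace Summit.QuantumFields.QCD.Cruxes.FrameAPrioriBound.CubeCofactor

open scoped BigOperators Matrix
open MeasureTheory Filter Literature.MathematicalPhysics.QuantumFieldTheory
  Literature.MathematicalPhysics.QuantumLattice Literature.Probability.LatticeModels

namespace FibreMoment

variable {L : ℕ}

/-- `W ↦ |det (hz (refit S U W) m₀ z)|` is continuous on the fibre (the refit is coordinatewise a
projection or a constant; `D_W` is continuous in the links). -/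
theorem continuous_norm_det_hz_refit [NeZero L] (S : Edge 4 L → Bool) (U : GaugeConfig 4 L SU3)
    (m₀ : ℝ) (z : ℂ) :
    Continuous fun W : GaugeConfig 4 L SU3 => ‖(hz (refit S U W) m₀ z).det‖ := by
  have hrefit : Continuous fun W : GaugeConfig 4 L SU3 => refit S U W := by
    refine continuous_pi fun e => ?_
    by_cases h : S e = true
    · simp only [refit, h, ↓reduceIte]; exact continuous_apply e
    · simp only [refit, h, Bool.false_eq_true, ↓reduceIte]; exact continuous_const
  exact ((continuous_const.matrix_mul ((continuous_wilsonDirac (fundamentalRep (Fin 3))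
    (continuous_fundamentalRep (Fin 3)) m₀ 1).comp hrefit)).sub continuous_const).matrix_det.norm

/-- `det (hz V m₀ z) ≠ 0` for `Im z ≠ 0`: `γ₅ D_W(V; m₀, 1)` is Hermitian, so its spectrum is real. -/
theorem det_hz_ne_zero [NeZero L] (V : GaugeConfig 4 L SU3) (m₀ : ℝ) {z : ℂ} (hzim : z.im ≠ 0) :
    (hz V m₀ z).det ≠ 0 :=
  det_sub_smul_one_ne_zero_of_isHermitian
    (isHermitian_gammaFive_mul_wilsonDirac_fundamental V m₀ 1) hzim

/-- Cramer: for `det A ≠ 0`, `|(A⁻¹)_{pq}| · |det A| = |(adj A)_{pq}|`. -/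
theorem norm_inv_apply_mul_norm_det {n : Type*} [Fintype n] [DecidableEq n] (A : Matrix n n ℂ)
    (hA : A.det ≠ 0) (p q : n) : ‖A⁻¹ p q‖ * ‖A.det‖ = ‖A.adjugate p q‖ := by
  rw [Matrix.inv_def, Matrix.smul_apply, smul_eq_mul, Ring.inverse_eq_inv, norm_mul, norm_inv,
    mul_right_comm, inv_mul_cancel₀ (norm_ne_zero_iff.mpr hA), one_mul]

/-- The abstract fibre bound: if `F > 0` has `∫ F^(-s) ≤ K F₀^(-s)` (integrably) and `G ≥ 0` obeys
`G · F ≤ C₁ F₀` pointwise, then `∫ G^s ≤ K C₁^s`. -/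
theorem integral_rpow_le_of_mul_le {Ω : Type*} [MeasurableSpace Ω] (μ : Measure Ω)
    {F G : Ω → ℝ} {F₀ K C₁ s : ℝ} (hs : 0 < s) (hF : ∀ ω, 0 < F ω) (hF₀ : 0 < F₀) (hC₁ : 0 ≤ C₁)
    (hint : Integrable (fun ω => F ω ^ (-s)) μ) (hle : ∫ ω, F ω ^ (-s) ∂μ ≤ K * F₀ ^ (-s))
    (hG : ∀ ω, 0 ≤ G ω) (hGF : ∀ ω, G ω * F ω ≤ C₁ * F₀) :
    ∫ ω, G ω ^ s ∂μ ≤ K * C₁ ^ s := by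
  have hpt : ∀ ω, G ω ^ s ≤ (C₁ * F₀) ^ s * F ω ^ (-s) := by
    intro ω
    have h1 : G ω ≤ C₁ * F₀ / F ω := by
      rw [le_div_iff₀ (hF ω)]
      exact hGF ω
    calc G ω ^ s ≤ (C₁ * F₀ / F ω) ^ s := Real.rpow_le_rpow (hG ω) h1 hs.le
      _ = (C₁ * F₀) ^ s * F ω ^ (-s) := by
        rw [Real.div_rpow (mul_nonneg hC₁ hF₀.le) (hF ω).le, Real.rpow_neg (hF ω).le,
          div_eq_mul_inv]
  have hF₀s : F₀ ^ s ≠ 0 := (Real.rpow_pos_of_pos hF₀ s).ne'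
  calc ∫ ω, G ω ^ s ∂μ ≤ ∫ ω, (C₁ * F₀) ^ s * F ω ^ (-s) ∂μ :=
        integral_mono_of_nonneg (Eventually.of_forall fun ω => Real.rpow_nonneg (hG ω) s)
          (hint.const_mul _) (Eventually.of_forall hpt)
    _ = (C₁ * F₀) ^ s * ∫ ω, F ω ^ (-s) ∂μ := integral_const_mul _ _
    _ ≤ (C₁ * F₀) ^ s * (K * F₀ ^ (-s)) :=
        mul_le_mul_of_nonneg_left hle (Real.rpow_nonneg (mul_nonneg hC₁ hF₀.le) s)
    _ = K * C₁ ^ s := by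
        rw [Real.mul_rpow hC₁ hF₀.le, Real.rpow_neg hF₀.le, mul_mul_mul_comm,
          mul_inv_cancel₀ hF₀s, mul_one, mul_comm]

end FibreMoment

/-- STUB `fibreMoment` (the probabilistic core on the two-cube fibre).  Relative small balls for
`W ↦ |det hz(refit W)|` under product Haar (hypothesis 1) and the `ℓ¹` domination of the `(x, y)`
adjugate block by `C₁ · sup_fibre |det|` (hypothesis 2) give an exterior-uniform fractional-moment
bound `∫ (Σ_{a,i,b,j} |(hz(refit W)⁻¹)_{(x,a,i),(y,b,j)}|)^s dHaar^{⊗E}(W) ≤ C₀` for some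
`s ∈ (0, 1)`, all `Im z ≠ 0` (dyadic layer cake at a fibre maximiser of `|det|`, Cramer's rule). -/
theorem stub_fibreMoment :
    (∃ c α : ℝ, 0 < c ∧ 0 < α ∧ ∀ (L : ℕ) [NeZero L], 4 ≤ L →
      ∀ (m₀ : ℝ) (z : ℂ) (x y : TorusSite 4 L) (U W₀ : GaugeConfig 4 L SU3),
      (hz (refit (touches x y) U W₀) m₀ z).det ≠ 0 → ∀ ε : ℝ, 0 < ε →
      haarPi L {W | ‖(hz (refit (touches x y) U W) m₀ z).det‖ ≤
          ε * ‖(hz (refit (touches x y) U W₀) m₀ z).det‖} ≤ ENNReal.ofReal (c * ε ^ α)) →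
    (∃ C₁ : ℝ, 0 < C₁ ∧ ∀ (L : ℕ) [NeZero L], 4 ≤ L →
      ∀ (m₀ : ℝ), -2 ≤ m₀ → m₀ ≤ 2 → ∀ (z : ℂ), ‖z‖ ≤ 1 → ∀ (x y : TorusSite 4 L)
      (U W₀ : GaugeConfig 4 L SU3), ∃ W' : GaugeConfig 4 L SU3,
      (∑ a : Fin 3, ∑ i : Fin 4, ∑ b : Fin 3, ∑ j : Fin 4,
          ‖(hz (refit (touches x y) U W₀) m₀ z).adjugate (x, a, i) (y, b, j)‖) ≤
        C₁ * ‖(hz (refit (touches x y) U W') m₀ z).det‖) →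
    ∃ s C₀ : ℝ, 0 < s ∧ s < 1 ∧ 0 < C₀ ∧ ∀ (L : ℕ) [NeZero L], 4 ≤ L →
      ∀ (m₀ : ℝ), -2 ≤ m₀ → m₀ ≤ 2 → ∀ (z : ℂ), z.im ≠ 0 → ‖z‖ ≤ 1 → ∀ (x y : TorusSite 4 L)
      (U : GaugeConfig 4 L SU3),
      ∫ W, (∑ a : Fin 3, ∑ i : Fin 4, ∑ b : Fin 3, ∑ j : Fin 4,
          ‖(hz (refit (touches x y) U W) m₀ z)⁻¹ (x, a, i) (y, b, j)‖) ^ s ∂(haarPi L) ≤ C₀ := by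
  rintro ⟨c, α, hc, hα, h₁⟩ ⟨C₁, hC₁, h₂⟩
  -- the constants `s := min (α/2) (1/2)`, the layer-cake `K = K(c, α, s)`, and `C₀ := K · C₁^s`
  obtain ⟨s, hs_def⟩ : ∃ s : ℝ, s = min (α / 2) (1 / 2) := ⟨_, rfl⟩
  have hs : 0 < s := hs_def ▸ lt_min (half_pos hα) one_half_pos
  have hs1 : s < 1 := hs_def ▸ (min_le_right _ _).trans_lt one_half_lt_one
  have hsα : s < α := hs_def ▸ (min_le_left _ _).trans_lt (half_lt_self hα)
  obtain ⟨K, hK, hlc⟩ :=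
    PhaseQuenchedFlavourDecay.CrossingSplitIntegrability.stub_negMomentOfSmallBalls c α s hc.le hs hsα
  refine ⟨s, K * C₁ ^ s, hs, hs1, mul_pos hK (Real.rpow_pos_of_pos hC₁ s), ?_⟩
  intro L _ hL m₀ hm₁ hm₂ z hzim hz1 x y U
  -- the fibre functional `Fd W := |det hz(refit W)|`: continuous, positive, with a maximiser `Wm`
  set Fd : GaugeConfig 4 L SU3 → ℝ := fun W => ‖(hz (refit (touches x y) U W) m₀ z).det‖
    with hFd_def
  have hFc : Continuous Fd := FibreMoment.continuous_norm_det_hz_refit _ U m₀ z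
  have hFpos : ∀ W, 0 < Fd W := fun W =>
    norm_pos_iff.mpr (FibreMoment.det_hz_ne_zero _ m₀ hzim)
  obtain ⟨Wm, -, hWm⟩ := (isCompact_univ (X := GaugeConfig 4 L SU3)).exists_isMaxOn
    Set.univ_nonempty hFc.continuousOn
  have hmax : ∀ W, Fd W ≤ Fd Wm := fun W => hWm (Set.mem_univ W)
  haveI : IsProbabilityMeasure (haarPi L) := by dsimp only [haarPi]; infer_instance
  -- hypothesis 1 at `W₀ := Wm`: the small-ball input of the layer cake
  have hsmall : ∀ ε : ℝ, 0 < ε → (haarPi L {W | Fd W ≤ ε * Fd Wm}).toReal ≤ c * ε ^ α :=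
    fun ε hε => ENNReal.toReal_le_of_le_ofReal (by positivity)
      (h₁ L hL m₀ z x y U Wm (FibreMoment.det_hz_ne_zero _ m₀ hzim) ε hε)
  obtain ⟨hint, hle⟩ := hlc (GaugeConfig 4 L SU3) (haarPi L) Fd (Fd Wm) hFc.measurable
    (fun W => (hFpos W).le) (hFpos Wm) hsmall
  -- pointwise Cramer + hypothesis 2 (at `W₀ := W`) + maximality, then integrate
  refine FibreMoment.integral_rpow_le_of_mul_le (haarPi L) hs hFpos (hFpos Wm) hC₁.le hint hle
    (fun W => by positivity) fun W => ?_
  obtain ⟨W', hW'⟩ := h₂ L hL m₀ hm₁ hm₂ z hz1 x y U W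
  have hA := FibreMoment.det_hz_ne_zero (refit (touches x y) U W) m₀ hzim
  calc (∑ a : Fin 3, ∑ i : Fin 4, ∑ b : Fin 3, ∑ j : Fin 4,
        ‖(hz (refit (touches x y) U W) m₀ z)⁻¹ (x, a, i) (y, b, j)‖) * Fd W
      = ∑ a : Fin 3, ∑ i : Fin 4, ∑ b : Fin 3, ∑ j : Fin 4,
          ‖(hz (refit (touches x y) U W) m₀ z).adjugate (x, a, i) (y, b, j)‖ := by
        simp only [Finset.sum_mul]
        exact Finset.sum_congr rfl fun a _ => Finset.sum_congr rfl fun i _ =>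
          Finset.sum_congr rfl fun b _ => Finset.sum_congr rfl fun j _ =>
            FibreMoment.norm_inv_apply_mul_norm_det _ hA _ _
    _ ≤ C₁ * Fd W' := hW'
    _ ≤ C₁ * Fd Wm := mul_le_mul_of_nonneg_left (hmax W') hC₁.le

end Summit.QuantumFields.QCD.Cruxes.FrameAPrioriBound.CubeCofactor

end
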